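import Literature.AlgebraicGeometry.HodgeTheory.VanishingCohomologyNontrivial
import Literature.AlgebraicGeometry.HodgeTheory.HypersurfaceComplementPoints
import Literature.AlgebraicGeometry.HodgeTheory.HypersurfaceComplexPoints
import HarnessLib

/-!
# The complex points of `X ∖ (X ∩ V₊(F))` are the closed subset `e(X(ℂ)) ∩ U_F` of `U_F = {[z] | F(z) ≠ 0} ⊆ ℂℙᴺ`

Family `hodge`, layer `Literature/AlgebraicGeometry/HodgeTheory`.  A brick (the topological
identification of the affine complement) of the Andreotti–Frankel input still missing for the
named fact `BFNP2009_vanishingCohomology_nontrivial` (Brosnan–Fang–Nie–Pearlstein 2009, Prop. 43;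
file `VanishingCohomologyNontrivial`): `VanishingCohomologyNontrivialProofs` reduces that fact
(`BFNP2009_vanishingCohomology_nontrivial.of_andreottiFrankel_of_eulerChar`) to the growth of
`-χ_top` of the smooth members of `|𝒪_X(d)|` and to the vanishing
`H_j((X ∖ Y)(ℂ); ℂ) = 0`, `j > 2n = dim X`, for the complement of a smooth hypersurface section
`Y = X ∩ V₊(F)`, phrased on the complex points `↥(range (Y(ℂ) → X(ℂ)))ᶜ` with their analytic
topology — Andreotti–Frankel 1959 / Voisin, *Hodge Theory and Complex Algebraic Geometry II*
(2003), Thm. 1.22, for the smooth affine variety `X ∖ Y = X ∩ D₊(F)`, which in print is a closed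
complex submanifold of the affine variety `U_F = ℙᴺ ∖ V₊(F)`.  Morse theory lives on the manifold
`ℂℙᴺ = ComplexProjectiveSpace N` (`Literature/Topology/FourManifolds`) and its open subset
`U_F = ComplexProjectiveSpace.hypersurfaceComplement F hF` (`HypersurfaceComplementPoints`, which
treats the case `X = ℙᴺ`).  This file identifies the two sides for an arbitrary embedded `X`:

* `ProjectiveEmbedding.toCP e : X(ℂ) → ℂℙᴺ` — the complex points of `X` read in the manifold `ℂℙᴺ`
  through the closed immersion `e : X ↪ ℙᴺ_ℂ` and Serre's comparison `ℙᴺ_ℂ(ℂ) ≃ₜ ℂℙᴺ` (GAGA §2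
  n°5; the tree's `complexPointsProjectiveSpaceHomeomorph`); a CLOSED EMBEDDING
  (`ProjectiveEmbedding.isClosedEmbedding_toCP`: closed immersions induce embeddings of complex
  points, `AlgPoints.isEmbedding_map_of_isClosedImmersion`, with image the closed set of points
  lying over `e(X)`);
* `notMem_range_map_hypersurfaceSectionι_iff` — a complex point `P` of `X` is NOT a point of the
  hypersurface section `Y = X ∩ V₊(F)` (`deg F ≥ 1`) iff `e(P) ∈ U_F`, i.e. `F(e(P)) ≠ 0`
  (the support of the zero scheme of `F(s)` is `e⁻¹(V₊(F))`, `range_hypersurfaceSectionι`;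
  `[z] ∈ D₊(F) ⟺ F(z) ≠ 0`, Hartshorne II Prop. 2.5);
* `complRangeHypersurfaceSectionHomeomorph` — hence `(X ∖ Y)(ℂ) = ↥(range (Y(ℂ) → X(ℂ)))ᶜ` is
  homeomorphic to the CLOSED subset `e(X(ℂ)) ∩ U_F` of `U_F`
  (`isClosed_preimage_val_range_toCP`), and `toCP` restricts to a closed embedding
  `(X ∖ Y)(ℂ) → U_F` (`isClosedEmbedding_toCPCompl`); in particular a function on `U_F` with compact
  sublevel sets restricts to one on `(X ∖ Y)(ℂ)` (`isCompact_preimage_toCPCompl`) — the properness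
  half of "the squared distance of the affine embedding of `X ∖ Y` is an exhausting Morse function"
  (Voisin II, proof of Thm. 1.22; Milnor, *Morse theory*, §7 p. 41).

Everything here is proved; no named facts are introduced.

## References

* [BrosnanFangNiePearlstein2009] P. Brosnan, H. Fang, Z. Nie, G. Pearlstein, Singularities of
  admissible normal functions, Invent. Math. 177 (2009), §5 Prop. 43 (arXiv:0711.0964, p. 11).
* [VoisinHodgeII2003] C. Voisin, Hodge Theory and Complex Algebraic Geometry II (CUP 2003), §1.2.2
  Thm. 1.22 and its proof.
* [SerreGAGA1956] J.-P. Serre, GAGA, Ann. Inst. Fourier 6 (1956), §2 n°5 Lemme 1 b), Prop. 2.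
* [Hartshorne1977] R. Hartshorne, Algebraic Geometry (1977), II Prop. 2.5, II Ex. 3.11(d).
-/

noncomputable section

open scoped LinearAlgebra.Projectivization
open CategoryTheory AlgebraicGeometry Topology
open Literature.Topology.FourManifolds Literature.AlgebraicGeometry.Motives
open Literature.NumberTheory.Transcendental (projPoint pt_projPoint_mk_mem_basicOpen_iff)

universe u

attribute [local instance] MvPolynomial.gradedAlgebra

/-! ### `X(ℂ)` inside the manifold `ℂℙᴺ` -/

namespace Literature.AlgebraicGeometry.Motives.ProjectiveEmbedding

variable {X : SchemeOver ℂ} (e : ProjectiveEmbedding X)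

/-- **`X(ℂ) → ℂℙᴺ`**: the complex points of the embedded projective scheme `e : X ↪ ℙᴺ_ℂ`, read in
the manifold `ℂℙᴺ` through `e` and Serre's comparison `ℙᴺ_ℂ(ℂ) ≃ₜ ℂℙᴺ` (GAGA §2 n°5).
[cite: SerreGAGA1956, §2 n°5 Prop. 2] -/
def toCP : ComplexPoints X → ComplexProjectiveSpace e.n :=
  complexPointsProjectiveSpaceHomeomorph e.n ∘ AlgPoints.map (L := ℂ) e.ι

/-- Unfolding `toCP`. [folklore] -/
theorem toCP_apply (P : ComplexPoints X) :
    e.toCP P = complexPointsProjectiveSpaceHomeomorph e.n (AlgPoints.map (L := ℂ) e.ι P) :=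
  rfl

/-- The image of `X(ℂ) → ℙᴺ(ℂ)` is the set of complex points of `ℙᴺ` lying over the closed set
`e(X)` (complex points lift uniquely along closed immersions, `AlgPoints.mem_range_map_iff_pt_mem`).
[cite: Hartshorne1977, II Ex. 3.11(d)] -/
theorem range_map_ι_eq :
    Set.range (AlgPoints.map (L := ℂ) e.ι) =
      {Q : ComplexPoints (projectiveSpace e.n ℂ) | Q.pt ∈ Set.range e.ι.left} := by
  haveI : IsClosedImmersion e.ι.left := e.isClosedImmersion
  ext Q
  exact AlgPoints.mem_range_map_iff_pt_mem e.ι Q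

/-- The image of `X(ℂ) → ℙᴺ(ℂ)` is closed in the analytic topology (it is the preimage under the
continuous `pt` of the Zariski-closed `e(X)`; the analytic topology refines the Zariski topology,
`AlgPoints.isOpen_setOf_pt_mem`). [cite: SerreGAGA1956, §2 n°5 Lemme 1 b)] -/
theorem isClosed_range_map_ι : IsClosed (Set.range (AlgPoints.map (L := ℂ) e.ι)) := by
  haveI : IsClosedImmersion e.ι.left := e.isClosedImmersion
  rw [e.range_map_ι_eq]
  have hc : IsClosed (Set.range e.ι.left) := e.ι.left.isClosedEmbedding.isClosed_range
  have : {Q : ComplexPoints (projectiveSpace e.n ℂ) | Q.pt ∈ Set.range e.ι.left} =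
      {Q : ComplexPoints (projectiveSpace e.n ℂ) | Q.pt ∈ (⟨(Set.range e.ι.left)ᶜ, hc.isOpen_compl⟩ :
        (projectiveSpace e.n ℂ).left.Opens)}ᶜ := by
    ext Q; simp
  rw [this]
  exact (AlgPoints.isOpen_setOf_pt_mem _).isClosed_compl

/-- **`X(ℂ) → ℂℙᴺ` is a closed embedding** (a closed immersion induces an embedding of complex
points with closed image, Serre GAGA §2 n°5 Lemme 1 b); composed with the homeomorphism
`ℙᴺ_ℂ(ℂ) ≃ₜ ℂℙᴺ`). [cite: SerreGAGA1956, §2 n°5 Lemme 1 b) and Prop. 2] -/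
theorem isClosedEmbedding_toCP : IsClosedEmbedding e.toCP := by
  haveI : IsClosedImmersion e.ι.left := e.isClosedImmersion
  have h1 : IsClosedEmbedding (AlgPoints.map (L := ℂ) e.ι) :=
    ⟨AlgPoints.isEmbedding_map_of_isClosedImmersion e.ι, e.isClosed_range_map_ι⟩
  exact (complexPointsProjectiveSpaceHomeomorph e.n).isClosedEmbedding.comp h1

/-- `X(ℂ) → ℂℙᴺ` is injective. [cite: SerreGAGA1956, §2 n°5 Lemme 1 b)] -/
theorem toCP_injective : Function.Injective e.toCP :=
  e.isClosedEmbedding_toCP.injective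

/-- `X(ℂ) → ℂℙᴺ` is continuous. [cite: SerreGAGA1956, §2 n°5 Lemme 1 b)] -/
theorem continuous_toCP : Continuous e.toCP :=
  e.isClosedEmbedding_toCP.continuous

/-- The image `e(X(ℂ)) ⊆ ℂℙᴺ` is closed. [cite: SerreGAGA1956, §2 n°5 Lemme 1 b)] -/
theorem isClosed_range_toCP : IsClosed (Set.range e.toCP) :=
  e.isClosedEmbedding_toCP.isClosed_range

end Literature.AlgebraicGeometry.Motives.ProjectiveEmbedding

/-! ### Complex points off a hypersurface section -/

namespace Literature.AlgebraicGeometry.HodgeTheory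

section Complement

variable {X : SchemeOver ℂ} (e : ProjectiveEmbedding X) {d : ℕ}
  (F : MvPolynomial (Fin (e.n + 1)) ℂ) (hF : F.IsHomogeneous d)

/-- The grading of `ℂ[x₀, …, x_N]` by degree (`ℙᴺ_ℂ = Proj 𝓐`). -/
local notation "𝓐" => MvPolynomial.homogeneousSubmodule (Fin (e.n + 1)) ℂ

/-- For a complex point `Q` of `ℙᴺ_ℂ` and a form `F` of degree `d ≥ 1`: `Q ∉ V₊(F)` iff, read in
`ℂℙᴺ`, `Q` lies in `U_F = {[z] | F(z) ≠ 0}` (`[z] ∈ D₊(F) ⟺ F(z) ≠ 0`, Hartshorne II Prop. 2.5;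
the tree's `pt_projPoint_mk_mem_basicOpen_iff`). [cite: Hartshorne1977, II Prop. 2.5] -/
theorem pt_notMem_zeroLocus_iff (hd : 0 < d) (Q : ComplexPoints (projectiveSpace e.n ℂ)) :
    Q.pt ∉ ProjectiveSpectrum.zeroLocus 𝓐 ({F} : Set (MvPolynomial (Fin (e.n + 1)) ℂ)) ↔
      complexPointsProjectiveSpaceHomeomorph e.n Q ∈
        ComplexProjectiveSpace.hypersurfaceComplement F hF := by
  obtain ⟨x, rfl⟩ := (complexPointsProjectiveSpaceHomeomorph e.n).symm.surjective Q
  rw [Homeomorph.apply_symm_apply]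
  induction x using ComplexProjectiveSpace.ind with
  | h v =>
    rw [complexPointsProjectiveSpaceHomeomorph_symm_mk,
      ComplexProjectiveSpace.mk_mem_hypersurfaceComplement_iff,
      ← pt_projPoint_mk_mem_basicOpen_iff e.n (v : Fin (e.n + 1) → ℂ) v.2 hd
        ((MvPolynomial.mem_homogeneousSubmodule d F).2 hF)]
    refine Iff.trans ?_ (Proj.mem_basicOpen 𝓐 F _).symm
    exact not_congr ((ProjectiveSpectrum.mem_zeroLocus _ _ _).trans Set.singleton_subset_iff)

/-- **Complex points off the hypersurface section.** For `deg F ≥ 1`, a complex point `P` of `X`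
is NOT in the image of `Y(ℂ) → X(ℂ)`, `Y = X ∩ V₊(F)` the hypersurface section
(`ProjectiveEmbedding.hypersurfaceSection`), iff `e(P) ∈ U_F = {[z] | F(z) ≠ 0} ⊆ ℂℙᴺ`: the
support of `Y` is `e⁻¹(V₊(F))` (`range_hypersurfaceSectionι`) and complex points lift along closed
immersions (`AlgPoints.mem_range_map_iff_pt_mem`).
[cite: GortzWedhorn2020, Section (13.13), p. 505] [cite: Hartshorne1977, II Prop. 2.5] -/
theorem notMem_range_map_hypersurfaceSectionι_iff (hd : 0 < d) (P : ComplexPoints X) :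
    P ∉ Set.range (AlgPoints.map (L := ℂ) (e.hypersurfaceSectionι F hF)) ↔
      e.toCP P ∈ ComplexProjectiveSpace.hypersurfaceComplement F hF := by
  rw [AlgPoints.mem_range_map_iff_pt_mem, hypersurfaceSectionι_left,
    ← hypersurfaceSectionι_left, range_hypersurfaceSectionι e F hF hd, Set.mem_preimage,
    ProjectiveEmbedding.toCP_apply, ← pt_notMem_zeroLocus_iff e F hF hd]
  rfl

/-- The set of complex points of `X` off the hypersurface section is the preimage of `U_F` under
`X(ℂ) → ℂℙᴺ` (`deg F ≥ 1`). [cite: Hartshorne1977, II Prop. 2.5] -/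
theorem compl_range_map_hypersurfaceSectionι_eq (hd : 0 < d) :
    (Set.range (AlgPoints.map (L := ℂ) (e.hypersurfaceSectionι F hF)))ᶜ =
      e.toCP ⁻¹' (ComplexProjectiveSpace.hypersurfaceComplement F hF : Set _) := by
  ext P
  exact notMem_range_map_hypersurfaceSectionι_iff e F hF hd P

/-- `(X ∖ Y)(ℂ)` is open in `X(ℂ)` (`Y(ℂ) → X(ℂ)` has closed image; here as the preimage of the open
`U_F`). [cite: SerreGAGA1956, §2 n°5 Lemme 1 b)] -/
theorem isOpen_compl_range_map_hypersurfaceSectionι (hd : 0 < d) :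
    IsOpen (Set.range (AlgPoints.map (L := ℂ) (e.hypersurfaceSectionι F hF)))ᶜ := by
  rw [compl_range_map_hypersurfaceSectionι_eq e F hF hd]
  exact (ComplexProjectiveSpace.hypersurfaceComplement F hF).isOpen.preimage e.continuous_toCP

/-- **`(X ∖ Y)(ℂ) → U_F`**: the restriction of `X(ℂ) → ℂℙᴺ` to the complex points off the
hypersurface section, landing in `U_F = {[z] | F(z) ≠ 0}` (`deg F ≥ 1`). [cite: VoisinHodgeII2003, §1.2.2 proof of Thm. 1.22] -/
def toCPCompl (hd : 0 < d) :
    ↥(Set.range (AlgPoints.map (L := ℂ) (e.hypersurfaceSectionι F hF)))ᶜ →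
      ↥(ComplexProjectiveSpace.hypersurfaceComplement F hF) :=
  fun P ↦ ⟨e.toCP P, (notMem_range_map_hypersurfaceSectionι_iff e F hF hd P).1 P.2⟩

/-- `(X ∖ Y)(ℂ) → U_F` is `X(ℂ) → ℂℙᴺ` on underlying points (unfolding). [folklore] -/
@[simp]
theorem coe_toCPCompl (hd : 0 < d)
    (P : ↥(Set.range (AlgPoints.map (L := ℂ) (e.hypersurfaceSectionι F hF)))ᶜ) :
    (toCPCompl e F hF hd P : ComplexProjectiveSpace e.n) = e.toCP P :=
  rfl

/-- **`(X ∖ Y)(ℂ) → U_F` is a closed embedding** (restriction of the closed embedding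
`X(ℂ) → ℂℙᴺ` over the open subset `U_F`). [cite: SerreGAGA1956, §2 n°5 Lemme 1 b)] -/
theorem isClosedEmbedding_toCPCompl (hd : 0 < d) : IsClosedEmbedding (toCPCompl e F hF hd) := by
  set S : Set (ComplexProjectiveSpace e.n) :=
    (ComplexProjectiveSpace.hypersurfaceComplement F hF : Set (ComplexProjectiveSpace e.n)) with hS
  have hcod : IsClosedEmbedding (S.restrictPreimage e.toCP) :=
    e.isClosedEmbedding_toCP.restrictPreimage S
  have hs : (Set.range (AlgPoints.map (L := ℂ) (e.hypersurfaceSectionι F hF)))ᶜ = e.toCP ⁻¹' S :=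
    compl_range_map_hypersurfaceSectionι_eq e F hF hd
  have : toCPCompl e F hF hd = S.restrictPreimage e.toCP ∘ Homeomorph.setCongr hs := by
    funext P; rfl
  rw [this]
  exact hcod.comp (Homeomorph.setCongr hs).isClosedEmbedding

/-- The image of `(X ∖ Y)(ℂ) → U_F` is `e(X(ℂ)) ∩ U_F`, read in `U_F`. [cite: VoisinHodgeII2003, §1.2.2 proof of Thm. 1.22] -/
theorem range_toCPCompl (hd : 0 < d) :
    Set.range (toCPCompl e F hF hd) = Subtype.val ⁻¹' Set.range e.toCP := by
  ext ⟨x, hx⟩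
  simp only [Set.mem_range, Set.mem_preimage, Subtype.ext_iff, coe_toCPCompl]
  constructor
  · rintro ⟨P, rfl⟩
    exact ⟨P, rfl⟩
  · rintro ⟨P, rfl⟩
    exact ⟨⟨P, (notMem_range_map_hypersurfaceSectionι_iff e F hF hd P).2 hx⟩, rfl⟩

/-- `e(X(ℂ)) ∩ U_F` is closed in `U_F`. [cite: SerreGAGA1956, §2 n°5 Lemme 1 b)] -/
theorem isClosed_preimage_val_range_toCP :
    IsClosed (Subtype.val ⁻¹' Set.range e.toCP :
      Set ↥(ComplexProjectiveSpace.hypersurfaceComplement F hF)) :=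
  e.isClosed_range_toCP.preimage continuous_subtype_val

/-- **`(X ∖ Y)(ℂ) ≃ₜ e(X(ℂ)) ∩ U_F`**: the complex points of `X` off the hypersurface section
`Y = X ∩ V₊(F)` (`deg F ≥ 1`), with their analytic topology, are homeomorphic to the closed subset
`e(X(ℂ)) ∩ U_F` of the open subset `U_F = {[z] | F(z) ≠ 0}` of the manifold `ℂℙᴺ` — the
topological shadow of "`X ∖ Y = X ∩ D₊(F)` is a closed subvariety of the affine variety
`ℙᴺ ∖ V₊(F)`" (Voisin II, proof of Thm. 1.22). [cite: VoisinHodgeII2003, §1.2.2 proof of Thm. 1.22]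
[cite: SerreGAGA1956, §2 n°5 Prop. 2] -/
def complRangeHypersurfaceSectionHomeomorph (hd : 0 < d) :
    ↥(Set.range (AlgPoints.map (L := ℂ) (e.hypersurfaceSectionι F hF)))ᶜ ≃ₜ
      ↥(Subtype.val ⁻¹' Set.range e.toCP :
        Set ↥(ComplexProjectiveSpace.hypersurfaceComplement F hF)) :=
  ((isClosedEmbedding_toCPCompl e F hF hd).isEmbedding.toHomeomorph).trans
    (Homeomorph.setCongr (range_toCPCompl e F hF hd))

/-- The homeomorphism `(X ∖ Y)(ℂ) ≃ₜ e(X(ℂ)) ∩ U_F` is `X(ℂ) → ℂℙᴺ` on underlying points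
(unfolding). [folklore] -/
@[simp]
theorem coe_coe_complRangeHypersurfaceSectionHomeomorph (hd : 0 < d)
    (P : ↥(Set.range (AlgPoints.map (L := ℂ) (e.hypersurfaceSectionι F hF)))ᶜ) :
    ((complRangeHypersurfaceSectionHomeomorph e F hF hd P : ↥(ComplexProjectiveSpace.hypersurfaceComplement F hF)) :
      ComplexProjectiveSpace e.n) = e.toCP P :=
  rfl

/-- **Properness transfers to `(X ∖ Y)(ℂ)`**: if `g : U_F → Z` has compact fibres over compact sets
in the sense that `g ⁻¹ K` is compact, then so does `g ∘ ((X ∖ Y)(ℂ) → U_F)` — the closed embedding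
pulls compact sets back to compact sets.  (Used with `g` the squared norm of the affine embedding
of `U_F`: its sublevel sets on `X ∖ Y` are compact; Milnor, *Morse theory* §7, p. 41.)
[cite: VoisinHodgeII2003, §1.2.2 proof of Thm. 1.22] -/
theorem isCompact_preimage_toCPCompl (hd : 0 < d)
    {K : Set ↥(ComplexProjectiveSpace.hypersurfaceComplement F hF)} (hK : IsCompact K) :
    IsCompact (toCPCompl e F hF hd ⁻¹' K) :=
  (isClosedEmbedding_toCPCompl e F hF hd).isCompact_preimage hK

end Complement

end Literature.AlgebraicGeometry.HodgeTheory
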